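import Summits.CriticalPhenomena.PercolationContinuityZ3.Theorems.PercNearOneGluingNoHeavyQuantFarGate3Assembly
import Summits.CriticalPhenomena.PercolationContinuityZ3.Theorems.PercNearOneGluingNoHeavyQuantFarGate3Items
import HarnessLib

/-!
# QUANT lane R8, front "FAR beyond trees", layer one — THE DEGREE-THREE GATE AT THE OBSERVER, XVI: the mid-crowd regime

builds on p205010 (kernel theorem, internal audit signed; external expert review pending)

Support file (`--supports stmt-CriticalPhenomena-4575`), seat `prim-quant-p1` (gen 28); memo
`run/shared/lean/prim/quant/prim-quant-p1-g28/FOR-LEAD-GATE3.md` §6e.  Standard axioms; no sorries; no definitions.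

**The mid-crowd regime** (pure item `A(ρ₀, u₂)` of the menu, memo §5, for the better-tied neighbour `r₂ ≥ r₁`; sits between the
few-relay regime of file XV and the crowd regime of file XIV, which takes over exactly at `n·pW₁₂ = 1 − p(1−W₁₂)`).  With the price
`ρ₀ = pW₁₂/(1 − p r₂)` and type values `t = (φ₀₀ − ρ₀ sub₀₀, (1−nρ₀)ψ₂₁, 1 − nρ₀, φ₃₀ − ρ₀ sub₃₀, 1 − nρ₀)` all twenty conditions of the
pure item reduce to TWO: `nρ₀ ≤ …` (below crowd) and `ρ₀ n (1 − f₂) ≥ W₂` (checked exactly against the LP menu, `num3/midA.py`).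
`Gate3.arith_pureA2` is the generic pure-`A(π,u₂)` item in the cover-lemma format; `Quant.farLayerOne_of_gate3_midcrowd` the row.
-/

noncomputable section

namespace Summit.CriticalPhenomena.PercolationContinuityZ3.Theorems

namespace Quant

open Finset MeasureTheory Set
open Literature.Probability.LatticeModels
open Literature.Probability.Percolation
open Bundle (offZ)
open scoped Classical

namespace Gate3

/-- **Pure item `A(π, u₂)`** in the cover-lemma format (no mean line): a price `0 ≤ π ≤ 1/n`, type values `t_T` below every cell
entry `φ − π·sub` (file XII), and the five type conditions `t_T ≥ (1 − nπ)·ψ_(2,T)` give the row from the cut at `u₂` and the outside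
cuts. [this work] -/
theorem arith_pureA2 (p r₁ r₂ nn π t0 t1 t2 t3 t4 : ℝ) (hπ0 : 0 ≤ π) (hπ1 : nn * π ≤ 1)
    (hta0 : t0 ≤ p * (1 - (1 - r₁) * (1 - r₂)) - π * (p * max r₁ r₂ * nn))
    (hta1 : t0 ≤ p - π * ((1 + p * max r₁ r₂ * (nn - 1))))
    (hta2 : t0 ≤ 1 - π * (nn))
    (htb₁0 : t1 ≤ (1 - (1 - p) * (1 - r₁)) - π * ((1 - (1 - p) * (1 - r₁)) * r₂ * nn))
    (htb₁1 : t1 ≤ 1 - π * ((1 + (1 - (1 - p) * (1 - r₁)) * r₂ * (nn - 1))))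
    (htb₁2 : t1 ≤ 1 - π * (nn))
    (htb₂0 : t2 ≤ (1 - (1 - p) * (1 - r₂)) - π * ((1 - (1 - p) * (1 - r₂)) * r₁ * nn))
    (htb₂1 : t2 ≤ 1 - π * ((1 + (1 - (1 - p) * (1 - r₂)) * r₁ * (nn - 1))))
    (htb₂2 : t2 ≤ 1 - π * (nn))
    (htc0 : t3 ≤ p * (1 - (1 - r₁) * (1 - r₂)) - π * (p * (1 - (1 - r₁) * (1 - r₂)) * nn))
    (htc1 : t3 ≤ p - π * ((1 + p * (1 - (1 - r₁) * (1 - r₂)) * (nn - 1))))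
    (htc2 : t3 ≤ 1 - π * (nn))
    (htd0 : t4 ≤ 1 - π * (0 * nn))
    (htd1 : t4 ≤ 1 - π * ((1 + 0 * (nn - 1))))
    (htd2 : t4 ≤ 1 - π * (nn))
    (hg0 : 0 ≤ t0 - (1 - nn * π) * (p * r₂))
    (hg1 : 0 ≤ t1 - (1 - nn * π) * (r₂ * (1 - (1 - p) * (1 - r₁))))
    (hg2 : 0 ≤ t2 - (1 - nn * π) * 1)
    (hg3 : 0 ≤ t3 - (1 - nn * π) * (p * (1 - (1 - r₁) * (1 - r₂))))
    (hg4 : 0 ≤ t4 - (1 - nn * π) * 1)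
    (t S a0 a1 a2 b10 b11 b12 b20 b21 b22 c0 c1 c2 d0 d1 d2 : ℝ)
    (hna0 : 0 ≤ a0)
    (hna1 : 0 ≤ a1)
    (hna2 : 0 ≤ a2)
    (hnb10 : 0 ≤ b10)
    (hnb11 : 0 ≤ b11)
    (hnb12 : 0 ≤ b12)
    (hnb20 : 0 ≤ b20)
    (hnb21 : 0 ≤ b21)
    (hnb22 : 0 ≤ b22)
    (hnc0 : 0 ≤ c0)
    (hnc1 : 0 ≤ c1)
    (hnc2 : 0 ≤ c2)
    (hnd0 : 0 ≤ d0)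
    (hnd1 : 0 ≤ d1)
    (hnd2 : 0 ≤ d2)
    (hsum : a0 + a1 + a2 + b10 + b11 + b12 + b20 + b21 + b22 + c0 + c1 + c2 + d0 + d1 + d2 = 1)
    (_hH1 : ((a0 + a1 + a2) + (c0 + c1 + c2) + (b20 + b21 + b22)) * ((a0 + a1 + a2) + (b10 + b11 + b12)) ≤ (a0 + a1 + a2))
    (_hH2 : ((a0 + a1 + a2) + (c0 + c1 + c2) + (b10 + b11 + b12)) * ((a0 + a1 + a2) + (b20 + b21 + b22)) ≤ (a0 + a1 + a2))
    (_hH3 : ((a0 + a1 + a2) + (b10 + b11 + b12) + (b20 + b21 + b22)) * ((a0 + a1 + a2) + (c0 + c1 + c2)) ≤ (a0 + a1 + a2))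
    (_hcv : (1 - p) * (r₁ * r₂) * ((a0 + a1 + a2) + (c0 + c1 + c2)) + (1 - p) * (r₁ * (1 - r₂)) * ((a0 + a1 + a2) + (c0 + c1 + c2) + (b20 + b21 + b22)) + (1 - p) * ((1 - r₁) * r₂) * ((a0 + a1 + a2) + (c0 + c1 + c2) + (b10 + b11 + b12)) + (1 - p) * ((1 - r₁) * (1 - r₂)) ≤ t)
    (_hc1 : p * ((1 - r₁) * r₂) * ((a0 + a1 + a2) + (b20 + b21 + b22)) + (1 - p) * (r₁ * r₂) * ((a0 + a1 + a2) + (c0 + c1 + c2)) + (p * ((1 - r₁) * (1 - r₂)) + (1 - p) * (r₁ * (1 - r₂)) + (1 - p) * ((1 - r₁) * r₂) + (1 - p) * ((1 - r₁) * (1 - r₂))) * ((a0 + a1 + a2) + (c0 + c1 + c2) + (b20 + b21 + b22)) ≤ t)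
    (hc2 : p * ((1 - r₂) * r₁) * ((a0 + a1 + a2) + (b10 + b11 + b12)) + (1 - p) * (r₂ * r₁) * ((a0 + a1 + a2) + (c0 + c1 + c2)) + (p * ((1 - r₂) * (1 - r₁)) + (1 - p) * (r₂ * (1 - r₁)) + (1 - p) * ((1 - r₂) * r₁) + (1 - p) * ((1 - r₂) * (1 - r₁))) * ((a0 + a1 + a2) + (c0 + c1 + c2) + (b10 + b11 + b12)) ≤ t)
    (hout : nn - S ≤ nn * t)
    (hsub : S ≤ (p * max r₁ r₂ * nn * a0 + (1 + p * max r₁ r₂ * (nn - 1)) * a1 + nn * a2) + ((1 - (1 - p) * (1 - r₁)) * r₂ * nn * b10 + (1 + (1 - (1 - p) * (1 - r₁)) * r₂ * (nn - 1)) * b11 + nn * b12) + ((1 - (1 - p) * (1 - r₂)) * r₁ * nn * b20 + (1 + (1 - (1 - p) * (1 - r₂)) * r₁ * (nn - 1)) * b21 + nn * b22) + (p * (1 - (1 - r₁) * (1 - r₂)) * nn * c0 + (1 + p * (1 - (1 - r₁) * (1 - r₂)) * (nn - 1)) * c1 + nn * c2) + ((1 : ℝ) * d1 + nn * d2)) 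:
    p * ((1 - r₁) * (1 - r₂)) * (a0 + c0) + (1 - p) * (r₁ * r₂) * (a0 + a1 + c0 + c1) + (1 - p) * (r₁ * (1 - r₂)) * (a0 + a1 + c0 + c1 + b20) + (1 - p) * ((1 - r₁) * r₂) * (a0 + a1 + c0 + c1 + b10) + (1 - p) * ((1 - r₁) * (1 - r₂)) * (a0 + a1 + c0 + c1 + b10 + b20) ≤ t := by
  have hcl := cells_lower p r₁ r₂ nn π t0 t1 t2 t3 t4 a0 a1 a2 b10 b11 b12 b20 b21 b22 c0 c1 c2 d0 d1 d2
    hna0 hna1 hna2 hnb10 hnb11 hnb12 hnb20 hnb21 hnb22 hnc0 hnc1 hnc2 hnd0 hnd1 hnd2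
    hta0 hta1 hta2 htb₁0 htb₁1 htb₁2 htb₂0 htb₂1 htb₂2 htc0 htc1 htc2 htd0 htd1 htd2
  have hMa : 0 ≤ a0 + a1 + a2 := by linarith only [hna0, hna1, hna2]
  have hMb1 : 0 ≤ b10 + b11 + b12 := by linarith only [hnb10, hnb11, hnb12]
  have hMb2 : 0 ≤ b20 + b21 + b22 := by linarith only [hnb20, hnb21, hnb22]
  have hMc : 0 ≤ c0 + c1 + c2 := by linarith only [hnc0, hnc1, hnc2]
  have hMd : 0 ≤ d0 + d1 + d2 := by linarith only [hnd0, hnd1, hnd2]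
  have pg0 := mul_nonneg hg0 hMa
  have pg1 := mul_nonneg hg1 hMb1
  have pg2 := mul_nonneg hg2 hMb2
  have pg3 := mul_nonneg hg3 hMc
  have pg4 := mul_nonneg hg4 hMd
  have hπs := mul_le_mul_of_nonneg_left hsub hπ0
  have hπo := mul_le_mul_of_nonneg_left hout hπ0
  have hqt : 0 ≤ (1 - nn * π) * (t - (p * ((1 - r₂) * r₁) * ((a0 + a1 + a2) + (b10 + b11 + b12)) + (1 - p) * (r₂ * r₁) * ((a0 + a1 + a2) + (c0 + c1 + c2)) + (p * ((1 - r₂) * (1 - r₁)) + (1 - p) * (r₂ * (1 - r₁)) + (1 - p) * ((1 - r₂) * r₁) + (1 - p) * ((1 - r₂) * (1 - r₁))) * ((a0 + a1 + a2) + (c0 + c1 + c2) + (b10 + b11 + b12)))) := mul_nonneg (sub_nonneg.2 hπ1) (by linarith only [hc2])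
  have eπn : nn * π * (a0 + a1 + a2 + b10 + b11 + b12 + b20 + b21 + b22 + c0 + c1 + c2 + d0 + d1 + d2) = nn * π := by rw [hsum, mul_one]
  linarith only [hcl, pg0, pg1, pg2, pg3, pg4, hπs, hπo, hqt, eπn, hsum]

/-- **Mid-crowd certificate, price form** (`r₁ ≤ r₂`, `π(1 − p r₂) = pW₁₂`): item `A(π, u₂)` with `t = (φ_00 − π sub_00,
(1−nπ)ψ_21, 1 − nπ, φ_30 − π sub_30, 1 − nπ)`. [this work] -/
theorem arith_midcrowd_price (p r₁ r₂ nn π : ℝ) (hp0 : 0 ≤ p) (hp1 : p ≤ 1) (hr10 : 0 ≤ r₁) (hr21 : r₂ ≤ 1) (h12r : r₁ ≤ r₂)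
    (hn : 1 ≤ nn) (hπ0 : 0 ≤ π) (hπD : π * (1 - p * r₂) = p * ((1 - r₁) * (1 - r₂)))
    (hπ1 : nn * π ≤ 1) (hU : nn * (p * ((1 - r₁) * (1 - r₂))) ≤ 1 - p * (1 - (1 - r₁) * (1 - r₂)))
    (hL2 : (1 - p) * (1 - r₂) ≤ π * nn * (1 - (1 - (1 - p) * (1 - r₂)) * r₁))
    (t S a0 a1 a2 b10 b11 b12 b20 b21 b22 c0 c1 c2 d0 d1 d2 : ℝ)
    (hna0 : 0 ≤ a0)
    (hna1 : 0 ≤ a1)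
    (hna2 : 0 ≤ a2)
    (hnb10 : 0 ≤ b10)
    (hnb11 : 0 ≤ b11)
    (hnb12 : 0 ≤ b12)
    (hnb20 : 0 ≤ b20)
    (hnb21 : 0 ≤ b21)
    (hnb22 : 0 ≤ b22)
    (hnc0 : 0 ≤ c0)
    (hnc1 : 0 ≤ c1)
    (hnc2 : 0 ≤ c2)
    (hnd0 : 0 ≤ d0)
    (hnd1 : 0 ≤ d1)
    (hnd2 : 0 ≤ d2)
    (hsum : a0 + a1 + a2 + b10 + b11 + b12 + b20 + b21 + b22 + c0 + c1 + c2 + d0 + d1 + d2 = 1)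
    (hH1 : ((a0 + a1 + a2) + (c0 + c1 + c2) + (b20 + b21 + b22)) * ((a0 + a1 + a2) + (b10 + b11 + b12)) ≤ (a0 + a1 + a2))
    (hH2 : ((a0 + a1 + a2) + (c0 + c1 + c2) + (b10 + b11 + b12)) * ((a0 + a1 + a2) + (b20 + b21 + b22)) ≤ (a0 + a1 + a2))
    (hH3 : ((a0 + a1 + a2) + (b10 + b11 + b12) + (b20 + b21 + b22)) * ((a0 + a1 + a2) + (c0 + c1 + c2)) ≤ (a0 + a1 + a2))
    (hcv : (1 - p) * (r₁ * r₂) * ((a0 + a1 + a2) + (c0 + c1 + c2)) + (1 - p) * (r₁ * (1 - r₂)) * ((a0 + a1 + a2) + (c0 + c1 + c2) + (b20 + b21 + b22)) + (1 - p) * ((1 - r₁) * r₂) * ((a0 + a1 + a2) + (c0 + c1 + c2) + (b10 + b11 + b12)) + (1 - p) * ((1 - r₁) * (1 - r₂)) ≤ t)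
    (hc1 : p * ((1 - r₁) * r₂) * ((a0 + a1 + a2) + (b20 + b21 + b22)) + (1 - p) * (r₁ * r₂) * ((a0 + a1 + a2) + (c0 + c1 + c2)) + (p * ((1 - r₁) * (1 - r₂)) + (1 - p) * (r₁ * (1 - r₂)) + (1 - p) * ((1 - r₁) * r₂) + (1 - p) * ((1 - r₁) * (1 - r₂))) * ((a0 + a1 + a2) + (c0 + c1 + c2) + (b20 + b21 + b22)) ≤ t)
    (hc2 : p * ((1 - r₂) * r₁) * ((a0 + a1 + a2) + (b10 + b11 + b12)) + (1 - p) * (r₂ * r₁) * ((a0 + a1 + a2) + (c0 + c1 + c2)) + (p * ((1 - r₂) * (1 - r₁)) + (1 - p) * (r₂ * (1 - r₁)) + (1 - p) * ((1 - r₂) * r₁) + (1 - p) * ((1 - r₂) * (1 - r₁))) * ((a0 + a1 + a2) + (c0 + c1 + c2) + (b10 + b11 + b12)) ≤ t)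
    (hout : nn - S ≤ nn * t)
    (hsub : S ≤ (p * max r₁ r₂ * nn * a0 + (1 + p * max r₁ r₂ * (nn - 1)) * a1 + nn * a2) + ((1 - (1 - p) * (1 - r₁)) * r₂ * nn * b10 + (1 + (1 - (1 - p) * (1 - r₁)) * r₂ * (nn - 1)) * b11 + nn * b12) + ((1 - (1 - p) * (1 - r₂)) * r₁ * nn * b20 + (1 + (1 - (1 - p) * (1 - r₂)) * r₁ * (nn - 1)) * b21 + nn * b22) + (p * (1 - (1 - r₁) * (1 - r₂)) * nn * c0 + (1 + p * (1 - (1 - r₁) * (1 - r₂)) * (nn - 1)) * c1 + nn * c2) + ((1 : ℝ) * d1 + nn * d2)) :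
    p * ((1 - r₁) * (1 - r₂)) * (a0 + c0) + (1 - p) * (r₁ * r₂) * (a0 + a1 + c0 + c1) + (1 - p) * (r₁ * (1 - r₂)) * (a0 + a1 + c0 + c1 + b20) + (1 - p) * ((1 - r₁) * r₂) * (a0 + a1 + c0 + c1 + b10) + (1 - p) * ((1 - r₁) * (1 - r₂)) * (a0 + a1 + c0 + c1 + b10 + b20) ≤ t := by
  have hn0 : 0 ≤ nn := by linarith only [hn]
  have hr20 : 0 ≤ r₂ := le_trans hr10 h12r
  have hr11 : r₁ ≤ 1 := le_trans h12r hr21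
  have hm : max r₁ r₂ = r₂ := max_eq_right h12r
  have hmx1 : π * (p * max r₁ r₂ * nn) = π * (p * r₂ * nn) := by rw [hm]
  have hmx2 : π * (p * max r₁ r₂) = π * (p * r₂) := by rw [hm]
  have hmx3 : (1 - nn * π) * (p * max r₁ r₂) = (1 - nn * π) * (p * r₂) := by rw [hm]
  have hπDn : π * (1 - p * r₂) * nn = p * ((1 - r₁) * (1 - r₂)) * nn := by rw [hπD]
  have hW12 : 0 ≤ (1 - r₁) * (1 - r₂) := mul_nonneg (sub_nonneg.2 hr11) (sub_nonneg.2 hr21)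
  have hW12le : (1 - r₁) * (1 - r₂) ≤ 1 := by
    have h := mul_le_mul (sub_le_self 1 hr10) (sub_le_self 1 hr20) (sub_nonneg.2 hr21) zero_le_one
    linarith only [h]
  have h1W1 : 0 ≤ 1 - (1 - p) * (1 - r₁) := by
    have h := mul_nonneg hp0 (sub_nonneg.2 hr11)
    linarith only [h, hr10]
  have h1W2 : 0 ≤ 1 - (1 - p) * (1 - r₂) := by
    have h := mul_nonneg hp0 (sub_nonneg.2 hr21)
    linarith only [h, hr20]
  have hW1le : 1 - (1 - p) * (1 - r₁) ≤ 1 := by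
    have h := mul_nonneg (sub_nonneg.2 hp1) (sub_nonneg.2 hr11)
    linarith only [h]
  have hW2le : 1 - (1 - p) * (1 - r₂) ≤ 1 := by
    have h := mul_nonneg (sub_nonneg.2 hp1) (sub_nonneg.2 hr21)
    linarith only [h]
  have hf10 : 0 ≤ r₂ * (1 - (1 - p) * (1 - r₁)) := mul_nonneg hr20 h1W1
  have hf1le : r₂ * (1 - (1 - p) * (1 - r₁)) ≤ 1 := by
    have h := mul_le_mul hr21 hW1le h1W1 zero_le_one
    linarith only [h]
  have hf2le : (1 - (1 - p) * (1 - r₂)) * r₁ ≤ 1 := by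
    have h := mul_le_mul hW2le hr11 hr10 zero_le_one
    linarith only [h]
  have hf3le : p * (1 - (1 - r₁) * (1 - r₂)) ≤ 1 := by
    have h := mul_le_mul hp1 (sub_le_self 1 hW12) (by linarith only [hW12le]) zero_le_one
    linarith only [h]
  have hπle1 : π ≤ 1 := by
    have h : π * 1 ≤ π * nn := mul_le_mul_of_nonneg_left hn hπ0
    linarith only [h, hπ1]
  have ca0 : p * (1 - (1 - r₁) * (1 - r₂)) - π * (p * max r₁ r₂ * nn) ≤ p * (1 - (1 - r₁) * (1 - r₂)) - π * (p * max r₁ r₂ * nn) := le_refl _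
  have ca1 : p * (1 - (1 - r₁) * (1 - r₂)) - π * (p * max r₁ r₂ * nn) ≤ p - π * ((1 + p * max r₁ r₂ * (nn - 1))) := by linarith only [hπD, hmx2]
  have ca2 : p * (1 - (1 - r₁) * (1 - r₂)) - π * (p * max r₁ r₂ * nn) ≤ 1 - π * (nn) := by linarith only [hπDn, hmx1, hU]
  have cb10 : (1 - nn * π) * (r₂ * (1 - (1 - p) * (1 - r₁))) ≤ (1 - (1 - p) * (1 - r₁)) - π * ((1 - (1 - p) * (1 - r₁)) * r₂ * nn) := by
    have h := mul_nonneg h1W1 (sub_nonneg.2 hr21)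
    have h' := mul_nonneg (mul_nonneg hn0 hπ0) hf10
    linarith only [h, h']
  have cb11 : (1 - nn * π) * (r₂ * (1 - (1 - p) * (1 - r₁))) ≤ 1 - π * ((1 + (1 - (1 - p) * (1 - r₁)) * r₂ * (nn - 1))) := by
    have h := mul_nonneg (sub_nonneg.2 hf1le) (sub_nonneg.2 hπle1)
    linarith only [h]
  have cb12 : (1 - nn * π) * (r₂ * (1 - (1 - p) * (1 - r₁))) ≤ 1 - π * (nn) := by
    have h := mul_nonneg (sub_nonneg.2 hπ1) (sub_nonneg.2 hf1le)
    linarith only [h]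
  have cb20 : 1 - π * (nn) ≤ (1 - (1 - p) * (1 - r₂)) - π * ((1 - (1 - p) * (1 - r₂)) * r₁ * nn) := by linarith only [hL2]
  have cb21 : 1 - π * (nn) ≤ 1 - π * ((1 + (1 - (1 - p) * (1 - r₂)) * r₁ * (nn - 1))) := by
    have h := mul_nonneg hπ0 (mul_nonneg (sub_nonneg.2 hn) (sub_nonneg.2 hf2le))
    linarith only [h]
  have cb22 : 1 - π * (nn) ≤ 1 - π * (nn) := le_refl _
  have cc0 : p * (1 - (1 - r₁) * (1 - r₂)) - π * (p * (1 - (1 - r₁) * (1 - r₂)) * nn) ≤ p * (1 - (1 - r₁) * (1 - r₂)) - π * (p * (1 - (1 - r₁) * (1 - r₂)) * nn) := le_refl _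
  have cc1 : p * (1 - (1 - r₁) * (1 - r₂)) - π * (p * (1 - (1 - r₁) * (1 - r₂)) * nn) ≤ p - π * ((1 + p * (1 - (1 - r₁) * (1 - r₂)) * (nn - 1))) := by
    have hx : r₂ ≤ 1 - (1 - r₁) * (1 - r₂) := by
      have h := mul_nonneg hr10 (sub_nonneg.2 hr21)
      linarith only [h]
    have h := mul_nonneg hπ0 (mul_nonneg hp0 (sub_nonneg.2 hx))
    linarith only [h, hπD]
  have cc2 : p * (1 - (1 - r₁) * (1 - r₂)) - π * (p * (1 - (1 - r₁) * (1 - r₂)) * nn) ≤ 1 - π * (nn) := by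
    have h := mul_nonneg (sub_nonneg.2 hf3le) (sub_nonneg.2 hπ1)
    linarith only [h]
  have cd0 : 1 - π * (nn) ≤ 1 - π * (0 * nn) := by
    have hx : 0 ≤ π * nn := mul_nonneg hπ0 hn0
    linarith only [hx]
  have cd1 : 1 - π * (nn) ≤ 1 - π * ((1 + 0 * (nn - 1))) := by
    have hx : π * 1 ≤ π * nn := mul_le_mul_of_nonneg_left hn hπ0
    linarith only [hx]
  have cd2 : 1 - π * (nn) ≤ 1 - π * (nn) := le_refl _
  have cg0 : 0 ≤ (p * (1 - (1 - r₁) * (1 - r₂)) - π * (p * max r₁ r₂ * nn)) - (1 - nn * π) * (p * r₂) := by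
    have h := mul_nonneg hp0 (mul_nonneg hr10 (sub_nonneg.2 hr21))
    linarith only [h, hmx1, hmx3]
  have cg1 : 0 ≤ ((1 - nn * π) * (r₂ * (1 - (1 - p) * (1 - r₁)))) - (1 - nn * π) * (r₂ * (1 - (1 - p) * (1 - r₁))) := le_of_eq (by ring)
  have cg2 : 0 ≤ (1 - π * (nn)) - (1 - nn * π) * 1 := le_of_eq (by ring)
  have cg3 : 0 ≤ (p * (1 - (1 - r₁) * (1 - r₂)) - π * (p * (1 - (1 - r₁) * (1 - r₂)) * nn)) - (1 - nn * π) * (p * (1 - (1 - r₁) * (1 - r₂))) := le_of_eq (by ring)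
  have cg4 : 0 ≤ (1 - π * (nn)) - (1 - nn * π) * 1 := le_of_eq (by ring)
  exact arith_pureA2 p r₁ r₂ nn π _ _ _ _ _ hπ0 hπ1 ca0 ca1 ca2 cb10 cb11 cb12 cb20 cb21 cb22 cc0 cc1 cc2 cd0 cd1 cd2 cg0 cg1 cg2 cg3 cg4
    t S a0 a1 a2 b10 b11 b12 b20 b21 b22 c0 c1 c2 d0 d1 d2 hna0 hna1 hna2 hnb10 hnb11 hnb12 hnb20 hnb21 hnb22 hnc0 hnc1 hnc2 hnd0 hnd1 hnd2 hsum hH1 hH2 hH3 hcv hc1 hc2 hout hsub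

/-- **Mid-crowd certificate** (pure real, cover-lemma format without the mean line; `r₁ ≤ r₂`). [this work] -/
theorem arith_midcrowd (p r₁ r₂ nn : ℝ) (hp0 : 0 ≤ p) (hp1 : p ≤ 1) (hr10 : 0 ≤ r₁) (hr21 : r₂ ≤ 1) (h12r : r₁ ≤ r₂)
    (hn : 1 ≤ nn) (hU : nn * (p * ((1 - r₁) * (1 - r₂))) ≤ 1 - p * (1 - (1 - r₁) * (1 - r₂)))
    (hL : (1 - p) * (1 - r₂) * (1 - p * r₂) ≤ nn * (p * ((1 - r₁) * (1 - r₂))) * (1 - (1 - (1 - p) * (1 - r₂)) * r₁)) :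
    ∀ (t S a0 a1 a2 b10 b11 b12 b20 b21 b22 c0 c1 c2 d0 d1 d2 : ℝ), 0 ≤ a0 → 0 ≤ a1 → 0 ≤ a2 → 0 ≤ b10 → 0 ≤ b11 → 0 ≤ b12 → 0 ≤ b20 → 0 ≤ b21 → 0 ≤ b22 → 0 ≤ c0 → 0 ≤ c1 → 0 ≤ c2 → 0 ≤ d0 → 0 ≤ d1 → 0 ≤ d2 →
        a0 + a1 + a2 + b10 + b11 + b12 + b20 + b21 + b22 + c0 + c1 + c2 + d0 + d1 + d2 = 1 →
        ((a0 + a1 + a2) + (c0 + c1 + c2) + (b20 + b21 + b22)) * ((a0 + a1 + a2) + (b10 + b11 + b12)) ≤ (a0 + a1 + a2) →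
        ((a0 + a1 + a2) + (c0 + c1 + c2) + (b10 + b11 + b12)) * ((a0 + a1 + a2) + (b20 + b21 + b22)) ≤ (a0 + a1 + a2) →
        ((a0 + a1 + a2) + (b10 + b11 + b12) + (b20 + b21 + b22)) * ((a0 + a1 + a2) + (c0 + c1 + c2)) ≤ (a0 + a1 + a2) →
        (1 - p) * (r₁ * r₂) * ((a0 + a1 + a2) + (c0 + c1 + c2)) + (1 - p) * (r₁ * (1 - r₂)) * ((a0 + a1 + a2) + (c0 + c1 + c2) + (b20 + b21 + b22)) + (1 - p) * ((1 - r₁) * r₂) * ((a0 + a1 + a2) + (c0 + c1 + c2) + (b10 + b11 + b12)) + (1 - p) * ((1 - r₁) * (1 - r₂)) ≤ t →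
        p * ((1 - r₁) * r₂) * ((a0 + a1 + a2) + (b20 + b21 + b22)) + (1 - p) * (r₁ * r₂) * ((a0 + a1 + a2) + (c0 + c1 + c2)) + (p * ((1 - r₁) * (1 - r₂)) + (1 - p) * (r₁ * (1 - r₂)) + (1 - p) * ((1 - r₁) * r₂) + (1 - p) * ((1 - r₁) * (1 - r₂))) * ((a0 + a1 + a2) + (c0 + c1 + c2) + (b20 + b21 + b22)) ≤ t →
        p * ((1 - r₂) * r₁) * ((a0 + a1 + a2) + (b10 + b11 + b12)) + (1 - p) * (r₂ * r₁) * ((a0 + a1 + a2) + (c0 + c1 + c2)) + (p * ((1 - r₂) * (1 - r₁)) + (1 - p) * (r₂ * (1 - r₁)) + (1 - p) * ((1 - r₂) * r₁) + (1 - p) * ((1 - r₂) * (1 - r₁))) * ((a0 + a1 + a2) + (c0 + c1 + c2) + (b10 + b11 + b12)) ≤ t →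
        nn - S ≤ nn * t →
        S ≤ (p * max r₁ r₂ * nn * a0 + (1 + p * max r₁ r₂ * (nn - 1)) * a1 + nn * a2) + ((1 - (1 - p) * (1 - r₁)) * r₂ * nn * b10 + (1 + (1 - (1 - p) * (1 - r₁)) * r₂ * (nn - 1)) * b11 + nn * b12) + ((1 - (1 - p) * (1 - r₂)) * r₁ * nn * b20 + (1 + (1 - (1 - p) * (1 - r₂)) * r₁ * (nn - 1)) * b21 + nn * b22) + (p * (1 - (1 - r₁) * (1 - r₂)) * nn * c0 + (1 + p * (1 - (1 - r₁) * (1 - r₂)) * (nn - 1)) * c1 + nn * c2) + ((1 : ℝ) * d1 + nn * d2) →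
        p * ((1 - r₁) * (1 - r₂)) * (a0 + c0) + (1 - p) * (r₁ * r₂) * (a0 + a1 + c0 + c1) + (1 - p) * (r₁ * (1 - r₂)) * (a0 + a1 + c0 + c1 + b20) + (1 - p) * ((1 - r₁) * r₂) * (a0 + a1 + c0 + c1 + b10) + (1 - p) * ((1 - r₁) * (1 - r₂)) * (a0 + a1 + c0 + c1 + b10 + b20) ≤ t := by
  intro t S a0 a1 a2 b10 b11 b12 b20 b21 b22 c0 c1 c2 d0 d1 d2 hna0 hna1 hna2 hnb10 hnb11 hnb12 hnb20 hnb21 hnb22 hnc0 hnc1 hnc2 hnd0 hnd1 hnd2 hsum hH1 hH2 hH3 hcv hc1 hc2 hout hsub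
  have hr20 : 0 ≤ r₂ := le_trans hr10 h12r
  have hr11 : r₁ ≤ 1 := le_trans h12r hr21
  have hW12 : 0 ≤ (1 - r₁) * (1 - r₂) := mul_nonneg (sub_nonneg.2 hr11) (sub_nonneg.2 hr21)
  by_cases hD : 0 < 1 - p * r₂
  · -- generic case: the price `π = pW₁₂ / (1 − p r₂)`
    have hπ0 : 0 ≤ p * ((1 - r₁) * (1 - r₂)) / (1 - p * r₂) := div_nonneg (mul_nonneg hp0 hW12) hD.le
    have hπD : p * ((1 - r₁) * (1 - r₂)) / (1 - p * r₂) * (1 - p * r₂) = p * ((1 - r₁) * (1 - r₂)) :=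
      div_mul_cancel₀ _ hD.ne'
    have hπDn : p * ((1 - r₁) * (1 - r₂)) / (1 - p * r₂) * (1 - p * r₂) * nn = p * ((1 - r₁) * (1 - r₂)) * nn := by rw [hπD]
    have hπ1 : nn * (p * ((1 - r₁) * (1 - r₂)) / (1 - p * r₂)) ≤ 1 := by
      have hx : r₂ ≤ 1 - (1 - r₁) * (1 - r₂) := by
        have h := mul_nonneg hr10 (sub_nonneg.2 hr21)
        linarith only [h]
      have e : (1 - p * r₂) * (1 - nn * (p * ((1 - r₁) * (1 - r₂)) / (1 - p * r₂))) =
          (1 - p * r₂) - p * ((1 - r₁) * (1 - r₂)) / (1 - p * r₂) * (1 - p * r₂) * nn := by ring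
      have hpos : (1 - p * r₂) * 0 ≤ (1 - p * r₂) * (1 - nn * (p * ((1 - r₁) * (1 - r₂)) / (1 - p * r₂))) := by
        rw [mul_zero, e, hπDn]
        have h := mul_nonneg hp0 (sub_nonneg.2 hx)
        linarith only [hU, h]
      have := le_of_mul_le_mul_left hpos hD
      linarith only [this]
    have hL2 : (1 - p) * (1 - r₂) ≤ p * ((1 - r₁) * (1 - r₂)) / (1 - p * r₂) * nn * (1 - (1 - (1 - p) * (1 - r₂)) * r₁) := by
      have e : (1 - p * r₂) * (p * ((1 - r₁) * (1 - r₂)) / (1 - p * r₂) * nn * (1 - (1 - (1 - p) * (1 - r₂)) * r₁)) =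
          p * ((1 - r₁) * (1 - r₂)) / (1 - p * r₂) * (1 - p * r₂) * nn * (1 - (1 - (1 - p) * (1 - r₂)) * r₁) := by ring
      have hpos : (1 - p * r₂) * ((1 - p) * (1 - r₂)) ≤
          (1 - p * r₂) * (p * ((1 - r₁) * (1 - r₂)) / (1 - p * r₂) * nn * (1 - (1 - (1 - p) * (1 - r₂)) * r₁)) := by
        rw [e, hπDn]
        linarith only [hL]
      exact le_of_mul_le_mul_left hpos hD
    exact arith_midcrowd_price p r₁ r₂ nn _ hp0 hp1 hr10 hr21 h12r hn hπ0 hπD hπ1 hU hL2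
      t S a0 a1 a2 b10 b11 b12 b20 b21 b22 c0 c1 c2 d0 d1 d2 hna0 hna1 hna2 hnb10 hnb11 hnb12 hnb20 hnb21 hnb22 hnc0 hnc1 hnc2 hnd0 hnd1 hnd2 hsum hH1 hH2 hH3 hcv hc1 hc2 hout hsub
  · -- degenerate case `p = r₂ = 1`: the price is `0`
    have h : p * r₂ ≤ 1 := by
      have h' := mul_le_mul hp1 hr21 hr20 zero_le_one
      linarith only [h']
    have hpr : p * r₂ = 1 := by linarith only [h, not_lt.1 hD]
    have hp : p = 1 := by
      by_contra hne
      have hlt : p < 1 := lt_of_le_of_ne hp1 hne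
      have : p * r₂ ≤ p * 1 := mul_le_mul_of_nonneg_left hr21 hp0
      linarith only [this, hlt, hpr]
    have hr : r₂ = 1 := by rw [hp, one_mul] at hpr; exact hpr
    subst hp; subst hr
    refine arith_midcrowd_price 1 r₁ 1 nn 0 hp0 hp1 hr10 hr21 h12r hn le_rfl (by ring) (by simp) hU (by norm_num)
      t S a0 a1 a2 b10 b11 b12 b20 b21 b22 c0 c1 c2 d0 d1 d2 hna0 hna1 hna2 hnb10 hnb11 hnb12 hnb20 hnb21 hnb22 hnc0 hnc1 hnc2 hnd0 hnd1 hnd2 hsum hH1 hH2 hH3 hcv hc1 hc2 hout hsub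

end Gate3

variable {n : ℕ}

/-- **FAR at layer one for the degree-three gate in the MID-CROWD regime** (pure item `A(ρ₀, u₂)`, `r₁ ≤ r₂`; memo §6e): with
`n ≥ 1` relays besides the gate, `n·pW₁₂ ≤ 1 − p(1−W₁₂)` (below the crowd threshold of file XIV) and
`W₂(1 − p r₂) ≤ n·pW₁₂·(1 − f₂)` (`W₂ = (1−p)(1−r₂)`, `f₂ = (1−W₂)r₁`), the cuts at `u₂` and outside give the row (no mean, any graph).
For `r₂ ≤ r₁` apply it with `u₁, u₂` exchanged. [this work] -/
theorem farLayerOne_of_gate3_midcrowd (w : Sym2 (Fin n) → unitInterval) (A : Finset (Fin n)) {o v u₁ u₂ : Fin n}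
    (hov : o ≠ v) (h1v : u₁ ≠ v) (h2v : u₂ ≠ v) (ho1 : o ≠ u₁) (ho2 : o ≠ u₂) (h12 : u₁ ≠ u₂)
    (hvA : v ∈ A) (h1A : u₁ ∈ A) (h2A : u₂ ∈ A)
    (hw : ∀ z : Fin n, z ≠ o → z ≠ u₁ → z ≠ u₂ → z ≠ v → (w s(v, z) : ℝ) = 0)
    (h12r : (w s(v, u₁) : ℝ) ≤ (w s(v, u₂) : ℝ)) (hn : 1 ≤ ((((A.erase v).erase u₁).erase u₂).card : ℝ))
    (hU : ((((A.erase v).erase u₁).erase u₂).card : ℝ) * ((w s(o, v) : ℝ) * ((1 - (w s(v, u₁) : ℝ)) * (1 - (w s(v, u₂) : ℝ)))) ≤ 1 - (w s(o, v) : ℝ) * (1 - (1 - (w s(v, u₁) : ℝ)) * (1 - (w s(v, u₂) : ℝ))))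
    (hL : (1 - (w s(o, v) : ℝ)) * (1 - (w s(v, u₂) : ℝ)) * (1 - (w s(o, v) : ℝ) * (w s(v, u₂) : ℝ)) ≤ ((((A.erase v).erase u₁).erase u₂).card : ℝ) * ((w s(o, v) : ℝ) * ((1 - (w s(v, u₁) : ℝ)) * (1 - (w s(v, u₂) : ℝ)))) * (1 - (1 - (1 - (w s(o, v) : ℝ)) * (1 - (w s(v, u₂) : ℝ))) * (w s(v, u₁) : ℝ)))
    (t : ℝ) (hcut : ∀ a ∈ A, (prodBernoulli w).real (openConn o a : Set (BondConfig (Fin n)))ᶜ ≤ t) :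
    (prodBernoulli w).real {ω : BondConfig (Fin n) | (A.filter fun a => ω ∈ openConn o a).card ≤ 1} ≤ t :=
  farLayerOne_of_gate3_of_cover_nomean w A hov h1v h2v ho1 ho2 h12 hvA h1A h2A hw
    (Gate3.arith_midcrowd (w s(o, v) : ℝ) (w s(v, u₁) : ℝ) (w s(v, u₂) : ℝ) ((((A.erase v).erase u₁).erase u₂).card : ℝ) (w s(o, v)).2.1 (w s(o, v)).2.2 (w s(v, u₁)).2.1 (w s(v, u₂)).2.2
      h12r hn hU hL) t hcut

end Quant

end Summit.CriticalPhenomena.PercolationContinuityZ3.Theorems
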